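import Literature.AlgebraicGeometry.HodgeTheory.DworkSexticPencilHodgeLociOfGriffithsQP
import Literature.AlgebraicGeometry.HodgeTheory.GriffithsHolomorphicHodgeSubbundlesQPHolds
import HarnessLib

/-!
# The dichotomy of the locus `{s : ξ|_{𝒳_s} ∈ F²}` on the Dwork pencil — DISCHARGED
# (Voisin I Thm. 10.3 ⟹ Voisin II Lemma 5.13 on the curve `D(ℂ)`)

Family `hodge`, layer `Literature/AlgebraicGeometry/HodgeTheory`; proof file (theorems only, no definition, no new
named fact). Written by the prover seat `hodge-nonav-20241-p1` (g20, cell `hodge-nonav`; fact claim #1 on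
`DworkSextic.Voisin2002_dworkPencil_hodgeFiltrationTwo_locus_dichotomy`, from `stmt-HodgeConjecture-24129`).

The named fact `DworkSextic.Voisin2002_dworkPencil_hodgeFiltrationTwo_locus_dichotomy` (`DworkSexticPencilHodgeLoci`:
for an open `B` of the base of the Dwork pencil, a tube class `ξ ∈ H⁴(π⁻¹B(ℂ); ℂ)` and `t ∈ B` at which the locus
`{s ∈ B : ξ|_{𝒳_s} ∈ F²H⁴(𝒳_s)}` accumulates, the locus is a neighbourhood of `t`) was reduced by this seat (g19,
`DworkSexticPencilHodgeLociOfGriffithsQP`) to Griffiths' theorem in its quasi-projective form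
`Griffiths1968_holomorphicHodgeSubbundlesQP`; the cell's programme GRIFFITHS-HOLOMORPHY (prover-Bx, 19716-p2,
20241-p1) PROVED that statement: `griffiths1968_holomorphicHodgeSubbundlesQP_holds`
(`GriffithsHolomorphicHodgeSubbundlesQPHolds`). Hence:

* `Voisin2002_dworkPencil_hodgeFiltrationTwo_locus_dichotomy_holds` — the named fact is a THEOREM (one application).

Honest scope: a discharge of one Dwork-pencil named fact; the residue fact
`DworkSextic.Voisin2003_dworkPencil_residues_infinitesimal` of the same route is untouched; nothing here says HC, HC_CM
or HC_AV is proved.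

## References

* [VoisinHodgeI2002] C. Voisin, Hodge Theory and Complex Algebraic Geometry I, CUP 2002, §10.2.1 Thm. 10.3, §9.2.1.
* [VoisinHodgeII2003] C. Voisin, Hodge Theory and Complex Algebraic Geometry II, CUP 2003, §5.3.1 Lemma 5.13.
* [Griffiths1968PeriodsII] P. Griffiths, Periods of integrals on algebraic manifolds II, Amer. J. Math. 90 (1968), Thm. 1.1.
-/

noncomputable section

namespace Literature.AlgebraicGeometry.HodgeTheory.DworkSextic

/-- **The dichotomy of the locus `{s : ξ|_{𝒳_s} ∈ F²}` on the Dwork pencil HOLDS** (Voisin I Thm. 10.3 ⟹ Voisin II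
Lemma 5.13 on the one-dimensional base): the named fact `Voisin2002_dworkPencil_hodgeFiltrationTwo_locus_dichotomy`
discharged by one application of the cell's theorem `griffiths1968_holomorphicHodgeSubbundlesQP_holds` to
`Voisin2002_dworkPencil_hodgeFiltrationTwo_locus_dichotomy_of_griffiths1968QP`.
[cite: VoisinHodgeI2002, §10.2.1 Thm. 10.3 and §9.2.1] [cite: VoisinHodgeII2003, §5.3.1 Lemma 5.13]
[cite: Griffiths1968PeriodsII, Thm. 1.1] -/
theorem Voisin2002_dworkPencil_hodgeFiltrationTwo_locus_dichotomy_holds :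
    Voisin2002_dworkPencil_hodgeFiltrationTwo_locus_dichotomy :=
  Voisin2002_dworkPencil_hodgeFiltrationTwo_locus_dichotomy_of_griffiths1968QP
    griffiths1968_holomorphicHodgeSubbundlesQP_holds

end Literature.AlgebraicGeometry.HodgeTheory.DworkSextic

end
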